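import Summits.CriticalPhenomena.PercolationContinuityZ3.Theorems.Transplant.SkelPhiApronKitDefs
import Summits.CriticalPhenomena.PercolationContinuityZ3.Theorems.Transplant.SkelPhiQStepsN
import HarnessLib

/-!
# Quasi-step rung (N3-b), BINDER WAVE, row Q02 «SkelPhiApronKitDefs» of WAVE-Q-BINDER-rows v0.6 under (ι) := `Skelφ.QStepsN G φ M`: THE KIT CENTRE OF A
# CONTACT WHEN THE BASE CHART HAS ONLY QUASI-STEPS — `ctCtrQ` (the column vertex `colPtQ` of cost `P.N` over the kit point), the pinned short region /
# face / apron kit geometry read through it (`ctQkQ`, `ctFaceQ`, `apronGeomQ`), and the §3 facts (`φ_ctCtr_q`, `ctCtr_mem_graphBall_q` radius `×P.N`,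
# `le_lin_ctCtr_q`, `shellD_le_sdepth_ctCtr_q`, face/region inclusions) — the twins of «SkelPhiApronKitDefs» §1/§3 (which assumed `Steps G φ`)

builds on p205010 (kernel theorem, internal audit signed; external expert review pending) — nothing in this file uses p205010; nothing here is a claim about any open node
((N3-b), the end state); no carrier, no node.  Lane `prim-bschramm`, seat `prim-hp-8` (gen 62; binder-wave pen, family Forced*/Root*/RunKits/ApronKitDefs — captain gen-1 g4,
lane INBOX 2026-08-27 07:25Z).  DEF row (four definitions, review-queued by D-0009).  Helper file (`--supports stmt-CriticalPhenomena-4575 --as helper`).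
WHY (hunk classes (i) binder, (ii) call site `colPt/colPt_spec hstep ↦ colPtQ/colPtQ_spec hq`, (iv) radius `×cost`; located item L-hp8-1, lane INBOX 07:30Z).
The tree file is TWO-MAP: the window map `ψ` already has quasi-steps of cost `P.N` (`ApronPrm.N`); the base chart `φ` had unit steps, used ONLY to place the kit
centre `ctCtr := colPt G φ t₁ (kitPt …)` (a choice in the graph ball of radius `‖kitPt − φ t₁‖₁ = kitK`).  Under the rung's currency the base chart has
`QStepsN G φ P.N` — the window cost `P.N` is taken as the COMMON cost bound of both maps (costs are upper bounds: `Skelφ.QStepsN.mono`; at the tops `ψ` is a run /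
cell frame of `φ`, whose cost dominates `φ`'s), so NO definition changes arity: `ctCtrQ := colPtQ G φ P.N t₁ (kitPt …)` («SkelPhiQStepsN» `colPtQ`/`colPtQ_spec`), the
ball radius becomes `P.N · kitK`, and `ctQkQ`/`ctFaceQ`/`apronGeomQ` are the tree definitions read through `ctCtrQ`.  The `ψ`-only residents (§1 `ctY/ctDir/ctT1/ctWire/
shellWinA/ctApron`, §2 footprints) are φ-step-free and stay imported.  Regression: `qStepsN_of_steps` (`P.N = 1`, `one_mul`).
* §1 **`ctCtrQ`**, `ctQkQ`, `ctFaceQ`, **`apronGeomQ`**;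
* §3 **`φ_ctCtr_q`**, **`ctCtr_mem_graphBall_q`** (radius `P.N · kitK`), `le_lin_ctCtr_q`, `shellD_le_sdepth_ctCtr_q`, `ctFace_subset_ctQk_q`, `ctQk_subset_shellWinA_q`,
  `ctQk_subset_Rg_q`, `exists_adj_of_mem_ctFace_q`, `mem_ctFace_q`.
[cite: KozmaNitzan2024, §4 Lemma 10, pp. 19–21 (Step III: seeds, v(P), U(P), "Q ⊆ S"), p. 26 ((29): columns)] [cite: MartineauTassion2017, §4.3]
-/

noncomputable section

open scoped Classical

namespace Summit.CriticalPhenomena.PercolationContinuityZ3.Theorems.Transplant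

namespace Skelφ

open Literature.Probability.Percolation Literature.Probability.LatticeModels SimpleGraph KNLevels
open Literature.Probability.Percolation.KozmaNitzan.Cells (oth oth_ne eq_oth_of_ne oth_oth)
open Literature.Barriers.CriticalPhenomena (graphBall graphBall_finite mem_graphBall_self graphBall_mono)
open Skel (winGraph winGraph_adj KitGeom)
open SkelI (slabPt tanOff tanTgt tanTgt_mem natAbs_tanTgt_sub_le tanSign natAbs_mul_tanSign)

variable {V : Type} [DecidableEq V]

/-! ## §1 The contact data read through the quasi-step kit centre -/

variable (G : SimpleGraph V) {ψ φ : V → Site 2} [G.LocallyFinite]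

/-- **The kit centre of a contact under quasi-steps of the base chart**: the column vertex of cost `P.N` over the kit point above the shell line
(`Skelφ.colPtQ`; twin of `ctCtr`). [this work] -/
def ctCtrQ {Lo Hi : Site 2} (SF : ∀ (i : Fin 2) (σ : ℤˣ), SideForm ψ φ Lo Hi i σ) (P : ApronPrm) (w₀ : V) (R : ℕ) (x : V) : V :=
  colPtQ G φ P.N (ctT1 G ψ P w₀ R Lo Hi x) ((SF (ctDir G ψ w₀ R Lo Hi x).1 (ctDir G ψ w₀ R Lo Hi x).2).kitPt (φ (ctT1 G ψ P w₀ R Lo Hi x)) (shellD P) P.A)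

/-- **The pinned short region** of a contact, read through the quasi-step kit centre: `Rg c ∩ shell window` (twin of `ctQk`). [this work] -/
def ctQkQ {Lo Hi : Site 2} (SF : ∀ (i : Fin 2) (σ : ℤˣ), SideForm ψ φ Lo Hi i σ) (Rg : V → Finset V) (P : ApronPrm) (w₀ : V) (R : ℕ) (x : V) :
    Finset V :=
  Rg (ctCtrQ G SF P w₀ R x) ∩ shellWinA G ψ w₀ R Lo Hi P.ℓs

/-- **The face** of a contact, read through the quasi-step kit centre: the vertices of its pinned short region adjacent to its apron (twin of `ctFace`).
[this work] -/
def ctFaceQ {Lo Hi : Site 2} (SF : ∀ (i : Fin 2) (σ : ℤˣ), SideForm ψ φ Lo Hi i σ) (Rg : V → Finset V) (P : ApronPrm) (w₀ : V) (R : ℕ) (x : V) :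
    Finset V :=
  (ctQkQ G SF Rg P w₀ R x).filter fun u => ∃ w ∈ ctApron G SF P w₀ R x, G.Adj w u

/-- **The apron kit geometry** of the window level under quasi-steps of the base chart (twin of `apronGeom`: NEAR contact — region = wired path ∪ apron,
face = `ctFaceQ`; FAR contact — region and face `{y}`). [this work] -/
def apronGeomQ {Lo Hi : Site 2} (SF : ∀ (i : Fin 2) (σ : ℤˣ), SideForm ψ φ Lo Hi i σ) (Rg : V → Finset V) (P : ApronPrm) (w₀ : V) (R : ℕ) :
    KitGeom V where
  y := ctY G ψ w₀ R Lo Hi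
  S := fun x => if ctY G ψ w₀ R Lo Hi x ∈ graphBall G w₀ (R - P.r₀) then ctWire G ψ P w₀ R Lo Hi x ∪ ctApron G SF P w₀ R x
    else {ctY G ψ w₀ R Lo Hi x}
  U := fun x => if ctY G ψ w₀ R Lo Hi x ∈ graphBall G w₀ (R - P.r₀) then ctFaceQ G SF Rg P w₀ R x else {ctY G ψ w₀ R Lo Hi x}

/-! ## §3 The quasi-step kit centre and the face -/

section Centre

variable {G} {w₀ : V} {R : ℕ} {Lo Hi : Site 2} (SF : ∀ (i : Fin 2) (σ : ℤˣ), SideForm ψ φ Lo Hi i σ) {P : ApronPrm}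

omit [DecidableEq V] [G.LocallyFinite] in
/-- The quasi-step kit centre sits over the kit point (under `QStepsN` of the base chart, cost `P.N`; twin of `φ_ctCtr`). [folklore] -/
theorem φ_ctCtr_q (hqφ : QStepsN G φ P.N) (x : V) :
    φ (ctCtrQ G SF P w₀ R x) = (SF (ctDir G ψ w₀ R Lo Hi x).1 (ctDir G ψ w₀ R Lo Hi x).2).kitPt (φ (ctT1 G ψ P w₀ R Lo Hi x)) (shellD P) P.A := by
  unfold ctCtrQ; exact (colPtQ_spec hqφ _ _).2

omit [DecidableEq V] [G.LocallyFinite] in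
/-- The quasi-step kit centre is within graph distance `P.N · kitK` of the stem end (radius `×P.N`; twin of `ctCtr_mem_graphBall`). [folklore] -/
theorem ctCtr_mem_graphBall_q (hqφ : QStepsN G φ P.N) (x : V) :
    ctCtrQ G SF P w₀ R x ∈ graphBall G (ctT1 G ψ P w₀ R Lo Hi x)
      (P.N * (SF (ctDir G ψ w₀ R Lo Hi x).1 (ctDir G ψ w₀ R Lo Hi x).2).kitK (φ (ctT1 G ψ P w₀ R Lo Hi x)) (shellD P) P.A) := by
  unfold ctCtrQ
  have h := (colPtQ_spec hqφ (ctT1 G ψ P w₀ R Lo Hi x) ((SF (ctDir G ψ w₀ R Lo Hi x).1 (ctDir G ψ w₀ R Lo Hi x).2).kitPt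
    (φ (ctT1 G ψ P w₀ R Lo Hi x)) (shellD P) P.A)).1
  refine graphBall_mono G _ (le_of_eq ?_) h
  congr 1
  set F := SF (ctDir G ψ w₀ R Lo Hi x).1 (ctDir G ψ w₀ R Lo Hi x).2
  unfold SideForm.kitPt
  by_cases ha : F.a = 0
  · rw [ha]; simp [Int.natAbs_mul]
  · have ha1 : F.a = 1 := by
      rcases Fin.eq_zero_or_eq_succ F.a with h | ⟨k, hk⟩
      · exact absurd h ha
      · rw [hk]; exact congrArg Fin.succ (Fin.eq_zero k)
    rw [ha1]; simp [Int.natAbs_mul]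

omit [DecidableEq V] [G.LocallyFinite] in
/-- **The quasi-step kit centre lies above the shell line by `A`**: `θ D + A ≤ L(φ c)`, provided `L(φ t₁) ≤ θ D + A` (twin of `le_lin_ctCtr`). [this work] -/
theorem le_lin_ctCtr_q (hqφ : QStepsN G φ P.N) {x : V}
    (ht : (SF (ctDir G ψ w₀ R Lo Hi x).1 (ctDir G ψ w₀ R Lo Hi x).2).lin (φ (ctT1 G ψ P w₀ R Lo Hi x)) ≤
      (SF (ctDir G ψ w₀ R Lo Hi x).1 (ctDir G ψ w₀ R Lo Hi x).2).θ (shellD P) + P.A) :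
    (SF (ctDir G ψ w₀ R Lo Hi x).1 (ctDir G ψ w₀ R Lo Hi x).2).θ (shellD P) + P.A ≤
      (SF (ctDir G ψ w₀ R Lo Hi x).1 (ctDir G ψ w₀ R Lo Hi x).2).lin (φ (ctCtrQ G SF P w₀ R x)) := by
  rw [φ_ctCtr_q SF hqφ]; exact SideForm.le_lin_kitPt _ ht

omit [DecidableEq V] [G.LocallyFinite] in
/-- Hence the quasi-step kit centre is at depth `≥ D` behind the exit side (twin of `shellD_le_sdepth_ctCtr`). [folklore] -/
theorem shellD_le_sdepth_ctCtr_q (hqφ : QStepsN G φ P.N) (hA : 0 ≤ P.A) {x : V}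
    (ht : (SF (ctDir G ψ w₀ R Lo Hi x).1 (ctDir G ψ w₀ R Lo Hi x).2).lin (φ (ctT1 G ψ P w₀ R Lo Hi x)) ≤
      (SF (ctDir G ψ w₀ R Lo Hi x).1 (ctDir G ψ w₀ R Lo Hi x).2).θ (shellD P) + P.A) :
    (shellD P : ℤ) ≤ sdepth ψ Lo Hi (ctDir G ψ w₀ R Lo Hi x).1 (ctDir G ψ w₀ R Lo Hi x).2 (ctCtrQ G SF P w₀ R x) :=
  (SF _ _).le_sdepth_of_lin (by have := le_lin_ctCtr_q SF hqφ ht; linarith)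

variable (Rg : V → Finset V)

/-- The face lies in the pinned short region (twin of `ctFace_subset_ctQk`). [folklore] -/
theorem ctFace_subset_ctQk_q (x : V) : ctFaceQ G SF Rg P w₀ R x ⊆ ctQkQ G SF Rg P w₀ R x := Finset.filter_subset _ _

/-- The pinned short region lies in the shell window (twin of `ctQk_subset_shellWinA`). [folklore] -/
theorem ctQk_subset_shellWinA_q (x : V) : ctQkQ G SF Rg P w₀ R x ⊆ shellWinA G ψ w₀ R Lo Hi P.ℓs := Finset.inter_subset_right

/-- The pinned short region lies in the short region of the quasi-step kit centre (twin of `ctQk_subset_Rg`). [folklore] -/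
theorem ctQk_subset_Rg_q (x : V) : ctQkQ G SF Rg P w₀ R x ⊆ Rg (ctCtrQ G SF P w₀ R x) := Finset.inter_subset_left

/-- Every face vertex has a neighbour in the apron (twin of `exists_adj_of_mem_ctFace`). [folklore] -/
theorem exists_adj_of_mem_ctFace_q {x u : V} (hu : u ∈ ctFaceQ G SF Rg P w₀ R x) : ∃ w ∈ ctApron G SF P w₀ R x, G.Adj w u :=
  (Finset.mem_filter.1 hu).2

/-- A vertex of the pinned short region with a neighbour in the apron is a face vertex (twin of `mem_ctFace`). [folklore] -/
theorem mem_ctFace_q {x u w : V} (hu : u ∈ ctQkQ G SF Rg P w₀ R x) (hw : w ∈ ctApron G SF P w₀ R x) (hadj : G.Adj w u) :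
    u ∈ ctFaceQ G SF Rg P w₀ R x :=
  Finset.mem_filter.2 ⟨hu, w, hw, hadj⟩

end Centre

end Skelφ

end Summit.CriticalPhenomena.PercolationContinuityZ3.Theorems.Transplant

end
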